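import Summits.QuantumFields.YangMills.Theorems.LangevinControlUVFemtoCurvatureTwoPointDefs
import Summits.QuantumFields.YangMills.Theorems.LangevinControlUVFemtoCurvatureTwoPointOffAxisDomination
import Summits.QuantumFields.YangMills.Theorems.LangevinControlUVFemtoCurvatureTwoPointDiagFamilies

/-!
# Route `LangevinControlUV`, item `FemtoCurvatureTwoPoint` (stmt-QuantumFields-9363), line `generic-step-gamma-encoding`:
# reduction of the fixed-torus all-pairs UPPER bound K2⁺ to the two diagonal profiles (DU₂)

Support file (`--supports stmt-QuantumFields-9363`), landed from the kernel-checked skeleton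
`Cruxes/FemtoCurvatureTwoPoint/Lines/generic_step_gamma_encoding.lean` (§ Reductions, reshape c1; § Composition glue) against
the tree vocabulary `…TwoPointDefs` and the LANDED structural theorems OA
`Theorems.FemtoCurvatureTwoPoint.stub_offAxisDomination` (`…OffAxisDomination`, p108776: reflection-positivity Cauchy–Schwarz,
β-uniform, every compact `G`) and the hypercubic family reduction `Theorems.FemtoCurvatureTwoPoint.diagFamilies_two_profiles`
(`…DiagFamilies`, p105493):

* `torusDist_le_two_mul_max` — torus distance is at most twice the largest coordinate distance;
* `pairUpper_of' : OffAxisDomination → DiagUpperFixedTorus → PairUpperFixedTorus` — pick the coordinate `μ` of largest torus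
  distance `m ≥ dist/2`, dominate `Cov²` by the two window sums of diagonal covariances (OA), bound every window term by
  `C β⁻² max(m−1,1)⁻⁸` (the index `0 (mod L)` is a variance), and use `dist⁸ ≤ 2⁸m⁸ ≤ 2¹⁶ max(m−1,1)⁸` (constant `196608·max C 0`);
* `diagUpper_of_twoProfiles : DiagUpperTwoProfiles → DiagUpperFixedTorus` (24 families = 2 profiles);
* the registered composition `pairUpperFixedTorus_of_twoProfiles : DiagUpperTwoProfiles → PairUpperFixedTorus` — the upper half
  of C⁺ from the two-profile statement DU₂ (`β² Var P ≤ C`, `β²|Cov(P_0^{01},P_{se₂}^{01})|·min(s,L−s)⁸ ≤ C`, same for `se₀`).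

An earlier submission (p116542, lead c2) bounced only for wrapping the landed OA theorem in an `*_holds` copy; here it is cited
directly.
-/

set_option autoImplicit false

noncomputable section

open scoped BigOperators Matrix
open MeasureTheory Filter Topology ProbabilityTheory

namespace Summit.QuantumFields.YangMills.Cruxes.FemtoCurvatureTwoPoint.GenericStepGammaEncoding

open Literature.MathematicalPhysics.QuantumFieldTheory

/-- Torus distance is at most twice the largest coordinate distance. -/
theorem torusDist_le_two_mul_max {L : ℕ} [NeZero L] (x y : Fin 4 → ZMod L) (μ : Fin 4)
    (hμ : ∀ k, ((x k - y k).valMinAbs).natAbs ≤ ((x μ - y μ).valMinAbs).natAbs) :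
    Real.sqrt (∑ k : Fin 4, (((x k - y k).valMinAbs : ℤ) : ℝ) ^ 2) ≤
      2 * (((x μ - y μ).valMinAbs).natAbs : ℝ) := by
  set m : ℕ := ((x μ - y μ).valMinAbs).natAbs with hm
  have hk : ∀ k, (((x k - y k).valMinAbs : ℤ) : ℝ) ^ 2 ≤ (m : ℝ) ^ 2 := fun k => by
    have h1 : |(((x k - y k).valMinAbs : ℤ) : ℝ)| = (((x k - y k).valMinAbs.natAbs : ℕ) : ℝ) := by
      rw [← Int.cast_abs, Int.abs_eq_natAbs, Int.cast_natCast]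
    have h2 : (((x k - y k).valMinAbs.natAbs : ℕ) : ℝ) ≤ m := by exact_mod_cast hμ k
    calc (((x k - y k).valMinAbs : ℤ) : ℝ) ^ 2 = |(((x k - y k).valMinAbs : ℤ) : ℝ)| ^ 2 :=
          (sq_abs _).symm
      _ ≤ (m : ℝ) ^ 2 := by rw [h1]; exact pow_le_pow_left₀ (Nat.cast_nonneg _) h2 2
  rw [Real.sqrt_le_iff]
  refine ⟨by positivity, ?_⟩
  calc ∑ k : Fin 4, (((x k - y k).valMinAbs : ℤ) : ℝ) ^ 2 ≤ ∑ _k : Fin 4, (m : ℝ) ^ 2 :=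
        Finset.sum_le_sum fun k _ => hk k
    _ = (2 * (m : ℝ)) ^ 2 := by simp; ring


/-- **OA ∧ DU ⇒ K2⁺** (the reshaped reduction of the all-pairs fixed-torus upper bound to the diagonal
families): pick the coordinate `μ` of largest torus distance `m ≥ dist/2`, dominate `Cov²` by the two
window sums of diagonal covariances (OA), bound every window term by `C β⁻² max(m−1,1)⁻⁸` (DU; the
index `0 (mod L)` is a variance), and use `dist⁸ ≤ 2⁸ m⁸ ≤ 2¹⁶ max(m−1,1)⁸`. -/
theorem pairUpper_of' (hOA : OffAxisDomination) (hDU : DiagUpperFixedTorus) :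
    PairUpperFixedTorus := by
  intro G _ _ _ _ _ _ hG r
  obtain ⟨B, C, hB⟩ := hDU G hG r
  refine ⟨fun L => max (B L) 0, 196608 * max C 0, ?_⟩
  intro L _ β hβ P E hP hE x y i j i' j' hxy hij hij'
  have hβB : B L ≤ β := (le_max_left _ _).trans hβ
  have hβ0 : 0 ≤ β := (le_max_right _ _).trans hβ
  obtain ⟨hVar, hDiag⟩ := hB L β hβB P E hP hE
  set C' : ℝ := max C 0 with hC'
  have hC'0 : 0 ≤ C' := le_max_right _ _
  have hCC' : C ≤ C' := le_max_left _ _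
  -- the coordinate of largest torus distance
  obtain ⟨μ, -, hμ⟩ := Finset.exists_max_image Finset.univ
    (fun k : Fin 4 => ((x k - y k).valMinAbs).natAbs) Finset.univ_nonempty
  set m : ℕ := ((x μ - y μ).valMinAbs).natAbs with hm
  have hμ' : ∀ k, ((x k - y k).valMinAbs).natAbs ≤ m := fun k => hμ k (Finset.mem_univ k)
  have hm1 : 1 ≤ m := by
    obtain ⟨k, hk⟩ : ∃ k, x k ≠ y k := by
      by_contra h
      push Not at h
      exact hxy (funext h)
    have : ((x k - y k).valMinAbs).natAbs ≠ 0 := by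
      rw [Ne, Int.natAbs_eq_zero, ZMod.valMinAbs_eq_zero]
      exact sub_ne_zero.2 hk
    have := hμ' k
    omega
  have hmL : 2 * m ≤ L := by
    have h := ZMod.natAbs_valMinAbs_le (x μ - y μ)
    omega
  have hmyx : ((y μ - x μ).valMinAbs).natAbs = m := by
    rw [← neg_sub, ZMod.natAbs_valMinAbs_neg]
  -- the distance
  set d : ℝ := Real.sqrt (∑ k : Fin 4, (((x k - y k).valMinAbs : ℤ) : ℝ) ^ 2) with hd
  have hd0 : 0 ≤ d := Real.sqrt_nonneg _
  have hd2m : d ≤ 2 * (m : ℝ) := torusDist_le_two_mul_max x y μ hμ'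
  -- the covariance
  set cv : ℝ := E (fun U => P x i j U * P y i' j' U) - E (P x i j) * E (P y i' j') with hcv
  -- trivial when `β = 0`
  rcases hβ0.eq_or_lt with hβz | hβpos
  · rw [← hβz]
    have : (0 : ℝ) ^ 2 * (|cv| * d ^ 8) = 0 := by ring
    rw [this]
    positivity
  -- window bound: every `|D(n)|` with `n ∈ {m-1, m, m+1}` is `≤ C'/(β² k⁸)`, `k = max (m-1) 1`
  set k : ℕ := max (m - 1) 1 with hk
  have hk1 : 1 ≤ k := le_max_right _ _
  have hkpos : (0 : ℝ) < k := by exact_mod_cast hk1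
  have hβ2 : 0 < β ^ 2 := by positivity
  have hterm : ∀ (a b : Fin 4), a ≠ b → ∀ s ∈ Finset.range 3,
      |E (fun U => P 0 a b U * P (Pi.single μ (((m - 1 + s : ℕ) : ℕ) : ZMod L)) a b U)
          - E (P 0 a b) * E (P (Pi.single μ (((m - 1 + s : ℕ) : ℕ) : ZMod L)) a b)|
        ≤ C' / (β ^ 2 * (k : ℝ) ^ 8) := by
    intro a b hab s hs
    have hs3 : s < 3 := Finset.mem_range.1 hs
    set n : ℕ := m - 1 + s with hn
    rw [le_div_iff₀ (by positivity)]
    by_cases hn0 : n = 0 ∨ n = L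
    · -- variance term
      have hcast : ((n : ℕ) : ZMod L) = 0 := by
        rcases hn0 with h | h
        · rw [h, Nat.cast_zero]
        · rw [h, ZMod.natCast_self]
      have hk1' : k = 1 := by
        rcases hn0 with h | h <;> simp only [hk] <;> omega
      rw [hcast, Pi.single_zero, hk1', Nat.cast_one, one_pow, mul_one]
      calc |E (fun U => P 0 a b U * P 0 a b U) - E (P 0 a b) * E (P 0 a b)| * β ^ 2
          = β ^ 2 * |E (fun U => P 0 a b U * P 0 a b U) - E (P 0 a b) * E (P 0 a b)| := by ring
        _ ≤ C := hVar a b hab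
        _ ≤ C' := hCC'
    · push Not at hn0
      have hn1 : 1 ≤ n := by omega
      have hnL : n + 1 ≤ L := by omega
      have h := hDiag a b μ n hab hn1 hnL
      -- `min n (L - n) ≥ k`
      have hmin : (k : ℝ) ≤ min (n : ℝ) ((L : ℝ) - n) := by
        rw [le_min_iff]
        constructor
        · exact_mod_cast (show k ≤ n by simp only [hk]; omega)
        · have : k + n ≤ L := by simp only [hk]; omega
          have : ((k + n : ℕ) : ℝ) ≤ L := by exact_mod_cast this
          push_cast at this
          linarith
      have hmin0 : (0 : ℝ) ≤ min (n : ℝ) ((L : ℝ) - n) := hkpos.le.trans hmin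
      set t := |E (fun U => P 0 a b U * P (Pi.single μ (((n : ℕ) : ℕ) : ZMod L)) a b U)
          - E (P 0 a b) * E (P (Pi.single μ (((n : ℕ) : ℕ) : ZMod L)) a b)| with ht
      have ht0 : 0 ≤ t := abs_nonneg _
      have h1 : t * (β ^ 2 * (k : ℝ) ^ 8) ≤ t * (β ^ 2 * (min (n : ℝ) ((L : ℝ) - n)) ^ 8) :=
        mul_le_mul_of_nonneg_left (mul_le_mul_of_nonneg_left
          (pow_le_pow_left₀ hkpos.le hmin 8) hβ2.le) ht0
      calc t * (β ^ 2 * (k : ℝ) ^ 8) ≤ t * (β ^ 2 * (min (n : ℝ) ((L : ℝ) - n)) ^ 8) := h1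
        _ = β ^ 2 * (t * (min (n : ℝ) ((L : ℝ) - n)) ^ 8) := by ring
        _ ≤ C := h
        _ ≤ C' := hCC'
  -- off-axis domination
  have hOA' := hOA G r.N r.ρ r.continuous L β hβ0 P E hP hE μ x y i j i' j' hij hij'
    (by rw [hmyx]; exact hm1)
  rw [hmyx] at hOA'
  have hS : ∀ (a b : Fin 4), a ≠ b →
      (∑ s ∈ Finset.range 3,
        |E (fun U => P 0 a b U * P (Pi.single μ (((m - 1 + s : ℕ) : ℕ) : ZMod L)) a b U)
          - E (P 0 a b) * E (P (Pi.single μ (((m - 1 + s : ℕ) : ℕ) : ZMod L)) a b)|)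
        ≤ 3 * (C' / (β ^ 2 * (k : ℝ) ^ 8)) := fun a b hab => by
    calc (∑ s ∈ Finset.range 3,
          |E (fun U => P 0 a b U * P (Pi.single μ (((m - 1 + s : ℕ) : ℕ) : ZMod L)) a b U)
            - E (P 0 a b) * E (P (Pi.single μ (((m - 1 + s : ℕ) : ℕ) : ZMod L)) a b)|)
        ≤ ∑ _s ∈ Finset.range 3, C' / (β ^ 2 * (k : ℝ) ^ 8) :=
          Finset.sum_le_sum fun s hs => hterm a b hab s hs
      _ = 3 * (C' / (β ^ 2 * (k : ℝ) ^ 8)) := by simp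
  set w : ℝ := C' / (β ^ 2 * (k : ℝ) ^ 8) with hw
  have hw0 : 0 ≤ w := by positivity
  have hsq : cv ^ 2 ≤ (3 * w) * (3 * w) := by
    refine hOA'.trans ?_
    have h1 := hS i j hij
    have h2 := hS i' j' hij'
    have h10 : 0 ≤ ∑ s ∈ Finset.range 3,
        |E (fun U => P 0 i j U * P (Pi.single μ (((m - 1 + s : ℕ) : ℕ) : ZMod L)) i j U)
          - E (P 0 i j) * E (P (Pi.single μ (((m - 1 + s : ℕ) : ℕ) : ZMod L)) i j)| :=
      Finset.sum_nonneg fun _ _ => abs_nonneg _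
    exact mul_le_mul h1 h2 (Finset.sum_nonneg fun _ _ => abs_nonneg _) (by positivity)
  have h9 : cv ^ 2 ≤ (3 * w) ^ 2 := by nlinarith [hsq]
  have habs : |cv| ≤ 3 * w := abs_le_of_sq_le_sq h9 (by positivity)
  -- assemble: `β² |cv| d⁸ ≤ β² · 3w · (2m)⁸ = 3 C' (2m/k)⁸ ≤ 3 C' 4⁸`
  have hmk : (m : ℝ) ≤ 2 * k := by
    have : m ≤ 2 * k := by simp only [hk]; omega
    exact_mod_cast this
  have hd8 : d ^ 8 ≤ (4 * (k : ℝ)) ^ 8 :=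
    pow_le_pow_left₀ hd0 (hd2m.trans (by linarith)) 8
  calc β ^ 2 * (|cv| * d ^ 8) ≤ β ^ 2 * ((3 * w) * (4 * (k : ℝ)) ^ 8) := by
        refine mul_le_mul_of_nonneg_left ?_ hβ2.le
        exact mul_le_mul habs hd8 (by positivity) (by positivity)
    _ = 196608 * C' := by
        simp only [hw]
        field_simp
        ring


/-- **Glue DU₂ ⇒ DU (proved; hypercubic symmetry).** The two-profile bounds give the 24-family bounds
via `Theorems.FemtoCurvatureTwoPoint.diagFamilies_two_profiles` (transverse families = the axis
profile, longitudinal families = the `e₀` profile; the variance clause is the case `s = 0`). -/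
theorem diagUpper_of_twoProfiles (h : DiagUpperTwoProfiles) : DiagUpperFixedTorus := by
  intro G _ _ _ _ _ _ hG r
  obtain ⟨B, C, hB⟩ := h G hG r
  refine ⟨B, C, fun L _ β hβ P E hP hE => ?_⟩
  obtain ⟨hVar, hST⟩ := hB L β hβ P E hP hE
  have two := Summit.QuantumFields.YangMills.Theorems.FemtoCurvatureTwoPoint.diagFamilies_two_profiles
    G r.N r.ρ r.continuous L β P E hP hE
  constructor
  · intro i j hij
    obtain ⟨k, hki, hkj⟩ := (show ∀ a b : Fin 4, ∃ k : Fin 4, k ≠ a ∧ k ≠ b by decide) i j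
    have h0 := (two i j k 0 hij).1 ⟨hki, hkj⟩
    simp only [Nat.cast_zero, Pi.single_zero] at h0
    rw [h0]
    exact hVar
  · intro i j μ s hij hs hsL
    by_cases hμ : μ ≠ i ∧ μ ≠ j
    · rw [(two i j μ s hij).1 hμ]
      exact (hST s hs hsL).1
    · have hμ' : μ = i ∨ μ = j := by tauto
      rw [(two i j μ s hij).2 hμ']
      exact (hST s hs hsL).2


/-- **Registered composition `pairUpperFixedTorus_of_twoProfiles`** (K2⁺ ⇐ DU₂): off-axis domination (landed OA) and the
two-profile diagonal bounds give the all-pairs fixed-torus upper bound with one `L`-uniform constant. -/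
theorem pairUpperFixedTorus_of_twoProfiles : DiagUpperTwoProfiles → PairUpperFixedTorus := fun h =>
  pairUpper_of' Summit.QuantumFields.YangMills.Theorems.FemtoCurvatureTwoPoint.stub_offAxisDomination
    (diagUpper_of_twoProfiles h)

end Summit.QuantumFields.YangMills.Cruxes.FemtoCurvatureTwoPoint.GenericStepGammaEncoding

end
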